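import Summits.Ventures.GridStability.Models.DroopQVGainQAffine
import Summits.Ventures.GridStability.Models.WSCC9DroopQVLossyGainBox2DCertH

/-!
# GridStability/Models/WSCC9DroopQVLossyGainBox2D — a TWO-PARAMETER certificate: for EVERY pair of uniform droop gains `(k_P, k_Q) ∈ [1, 10] × [1/10, 2/5]` the linearisation of the lossy construction «DROOPQV-WSCC9-LOSSY» at its (gain-independent) rest point is the rotation mode or has `Re z < −1`

Cell `gridfusion` (LADDER-GRIDFUSION, APEX LINE rung G3.b; seat gridfusion-model-8 (g4); default-work item (D) after lead g8 RULING 9ax (1), offered as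
«G3.b-ss-DROOPQV-WSCC9L-GAINBOX-2D»). Instance of `Models/DroopQVGainQAffine.lean` (generic: `withKQ`, `jacMatrix_withKP_withKQ_add`, `posDef_biaffine_of_corners`)
on #81's LOSSY object `WSCC9.droopQVL` with the data files `Models/WSCC9DroopQVLossyGainBox2DCert.lean` (+ `…CertH.lean`); the one-parameter box in `k_P` alone is
`Models/WSCC9DroopQVLossyGainBox.lean` (p560180).
STATEMENT (`droopQVL_gain2_eig_re_lt`): for all reals `k_P ∈ [1, 10]`, `k_Q ∈ [1/10, 2/5]`, every complex eigenpair `(z, v)` of the `9 × 9` Jacobian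
`jacMatrix (θ*, V*)` of `droopQVLkq k_P k_Q := (droopQVL.toMicrogrid.withKP (fun _ => k_P)).withKQ (fun _ => k_Q)` (the #81 construction with ALL SIX droop gains
replaced: P–f gains `k_P`, Q–V gains `k_Q`; rest point unchanged, `droopQVL_gain2_field_eq_zero`) is the rotation mode (`z = 0`, `v ∈ ℂ·r`) or has `Re z < −1`;
the rotation zero is algebraically simple (`droopQVL_gain2_no_jordan_chain_at_zero`). Printed gains `(243/100, 1/5)` inside; factor `10` in `k_P` times
factor `4` in `k_Q`.
CERTIFICATE (solver-free in the kernel; ONE multi-affine Lyapunov family, EIGHT integer Gram certificates): `J′(s, t) = defl9Q + s·J_P + t·J_Q` jointly AFFINE in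
the offsets `s = k_P − 243/100`, `t = k_Q − 1/5` (`DroopMicrogrid.jacDefl_withKP_withKQ_add`; `J_P` in the frequency rows, `J_Q` in the voltage rows);
`S(s, t) = T₀₀ + s·T₁₀ + t·T₀₁ + st·T₁₁` with `T₁₀` on the angle/voltage block, `T₀₁` on the angle/frequency block, `T₁₁` on the angle block ⇒ the four products
`T₁₀J_P`, `T₁₁J_P`, `T₀₁J_Q`, `T₁₁J_Q` vanish (`bx_zero_products`) ⇒ `H(s, t)` is MULTI-AFFINE (`lyapCert_biaffine`, §0) ⇒ `S ≻ 0` and `H ≻ 0` on the whole box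
from the four corners (`posDef_biaffine_of_corners`) ⇒ `eig_re_lt_neg_of_deflate` (p530169; `ζ = zetaL`, `γ = −3`). With slopes restricted to the angle block
the same box is LMI-infeasible (margin `−2.4e-4`); the (angle/voltage, angle/frequency) supports are what a two-parameter family needs.
DATA: packet `HOME/models/gen-model-8/g4/GAINBOX2D-WSCC9L-cert.json` (sha16 8b312c63cda43d35). Informative floats (ours, VALIDATED only): non-rotation abscissa on a `7 × 5` grid
of the box ∈ `[-1.0926, -1.0215]`; LMI margin `t* ≈ 1.3e-03`.
THREE COLUMNS. CERTIFIED (kernel): matrix statements about the MODEL `droopQVLkq k_P k_Q` on the box. MODELLED: MV-6N (KunduEtAl2019 (4a)–(4c) with Q–V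
dynamics) — SYNTHETIC/CONSTRUCTION as #81 (h12 `G` AND `B` of record, constant-impedance loads; `τ_P = τ_Q = 1/2` AS PRINTED [cite: KunduEtAl2019, §V];
`k_P`, `k_Q` the PARAMETERS; set-points DEFINED from `(θ*, V*)`). VALIDATED: the float LMI solve behind the `T`'s, float spectra. A statement about the
linearisation at ONE rest point over a BOX of gains — never a region of attraction, never the printed WSCC system; no sentence of this file says a grid,
a microgrid or a converter is stable.
-/

noncomputable section

open Real Matrix Finset
open scoped ComplexOrder
open Literature.Computation.Certificates

namespace Summit.Ventures.GridStability.Models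

/-! ## §0 The multi-affine certificate expansion -/

/-- **Multi-affine Lyapunov pencil.** With `S = S₀ + a·S₁ + b·S₂ + ab·S₃`, `J = J₀ + a·J₁ + b·J₂` and the four zero products `S₁J₁ = S₂J₂ = S₃J₁ = S₃J₂ = 0`,
the certificate matrix `S(−J) + (S(−J))ᵀ − c·S` is `H₀₀ + a·H₁₀ + b·H₀₁ + ab·H₁₁` with the explicit coefficients below. [folklore] -/
theorem lyapCert_biaffine {ι : Type*} [Fintype ι] (S₀ S₁ S₂ S₃ J₀ J₁ J₂ : Matrix ι ι ℝ) (c a b : ℝ)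
    (h11 : S₁ * J₁ = 0) (h22 : S₂ * J₂ = 0) (h31 : S₃ * J₁ = 0) (h32 : S₃ * J₂ = 0) :
    (S₀ + a • S₁ + b • S₂ + (a * b) • S₃) * (-(J₀ + a • J₁ + b • J₂)) + ((S₀ + a • S₁ + b • S₂ + (a * b) • S₃) * (-(J₀ + a • J₁ + b • J₂)))ᵀ
        - c • (S₀ + a • S₁ + b • S₂ + (a * b) • S₃)
      = (S₀ * (-J₀) + (S₀ * (-J₀))ᵀ - c • S₀)
        + a • (-(S₀ * J₁ + S₁ * J₀) - (S₀ * J₁ + S₁ * J₀)ᵀ - c • S₁)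
        + b • (-(S₀ * J₂ + S₂ * J₀) - (S₀ * J₂ + S₂ * J₀)ᵀ - c • S₂)
        + (a * b) • (-(S₁ * J₂ + S₂ * J₁ + S₃ * J₀) - (S₁ * J₂ + S₂ * J₁ + S₃ * J₀)ᵀ - c • S₃) := by
  simp only [Matrix.mul_neg, Matrix.add_mul, Matrix.mul_add, Matrix.smul_mul, Matrix.mul_smul, h11, h22, h31, h32, smul_zero, add_zero,
    Matrix.transpose_add, Matrix.transpose_neg, Matrix.transpose_smul, neg_add, smul_add, smul_neg, sub_eq_add_neg, smul_smul]
  module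

namespace WSCC9

/-! ## §1 The two-parameter family and its gain-independent rest point -/

/-- **The lossy construction with uniform droop gains `(k_P, k_Q)`** (all three units; filter constants and network as `droopQVL`). MODELLED:
SYNTHETIC/CONSTRUCTION, lossy, both gains parameters. [folklore] -/
def droopQVLkq (k kq : ℝ) : DroopMicrogrid 3 := (droopQVL.toMicrogrid.withKP (fun _ => k)).withKQ (fun _ => kq)

/-- The printed Q–V gains of the base instance: `k_Q = 1/5` on every unit. [cite: KunduEtAl2019, §V] -/
theorem droopQVL_kQ (i : Fin 3) : droopQVL.toMicrogrid.kQ i = (1 : ℝ) / 5 := by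
  have h : droopQVL.kQ i = 1 / 5 := rfl
  rw [DroopQVData.toMicrogrid_kQ, h]; push_cast; ring

/-- Moving both uniform gains: `(withKP (k_P + (k − 243/100)·1)).withKQ (k_Q + (kq − 1/5)·1) = droopQVLkq k kq`. [folklore] -/
theorem droopQVLkq_eq (k kq : ℝ) :
    (droopQVL.toMicrogrid.withKP (fun i => droopQVL.toMicrogrid.kP i + (k - 243 / 100) * (1 : ℝ))).withKQ
        (fun i => droopQVL.toMicrogrid.kQ i + (kq - 1 / 5) * (1 : ℝ)) = droopQVLkq k kq := by
  unfold droopQVLkq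
  have h1 : (fun i => droopQVL.toMicrogrid.kP i + (k - 243 / 100) * (1 : ℝ)) = fun _ => k := by
    funext i; rw [droopQVL_kP]; ring
  have h2 : (fun i => droopQVL.toMicrogrid.kQ i + (kq - 1 / 5) * (1 : ℝ)) = fun _ => kq := by
    funext i; rw [droopQVL_kQ]; ring
  rw [h1, h2]

/-- **The rest point does not move with the gains.** [folklore] -/
theorem droopQVL_gain2_field_eq_zero (k kq : ℝ) : (droopQVLkq k kq).field (droopQVL.angleOf, 0, droopQVL.Vstar) = 0 :=
  (droopQVL.toMicrogrid.withKP fun _ => k).withKQ_field_eq_zero (fun _ => kq)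
    ((droopQVL.toMicrogrid.withKP_isSteadyState_iff (fun _ => k) droopQVL.angleOf).2 droopQVL.isSteadyState)

/-- The Jacobian named below IS the derivative of the field of `droopQVLkq k kq` (generic kernel fact, every state). [folklore] -/
theorem droopQVL_gain2_hasFDerivAt_field (k kq : ℝ) (x : DroopMicrogrid.State 3) :
    HasFDerivAt (droopQVLkq k kq).field ((droopQVLkq k kq).jacCLM x) x :=
  (droopQVLkq k kq).hasFDerivAt_field x

/-! ## §2 Bridges: the deflated Jacobian of `droopQVLkq k kq` is `defl9Q + s·J_P + t·J_Q`, reindexed -/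

/-- The Q–V slope of the base instance IS `bxSlopeKQ9Q`, reindexed. [folklore] -/
theorem droopQVL_jacSlopeKQ_eq : droopQVL.toMicrogrid.jacSlopeKQ (fun _ => (1 : ℝ)) droopQVL.angleOf droopQVL.Vstar
    = (bxSlopeKQ9Q.map ((↑) : ℚ → ℝ)).submatrix e9 e9 := by
  rw [droopQVL.jacSlopeKQ_eq droopQVL_circle]
  ext a b
  have h := bxSlopeKQ9Q_spec a b
  simp only [DroopQVData.jacSlopeKQQ, Matrix.map_apply, Matrix.submatrix_apply, ← h]

/-- The real pencil of deflated Jacobians `J′(s, t) = defl9Q + s·J_P + t·J_Q` (flattened). [folklore] -/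
def bxJ9 (s t : ℝ) : Matrix (Fin 9) (Fin 9) ℝ :=
  defl9Q.map ((↑) : ℚ → ℝ) + s • slope9Q.map ((↑) : ℚ → ℝ) + t • bxSlopeKQ9Q.map ((↑) : ℚ → ℝ)

/-- **The deflated Jacobian of `droopQVLkq k kq` at `(θ*, V*)` IS `J′(k − 243/100, kq − 1/5)`, reindexed.** [folklore] -/
theorem droopQVLkq_jacDefl_eq (k kq : ℝ) : (droopQVLkq k kq).jacDefl droopQVL.angleOf droopQVL.Vstar zetaL
    = (bxJ9 (k - 243 / 100) (kq - 1 / 5)).submatrix e9 e9 := by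
  rw [← droopQVLkq_eq, DroopMicrogrid.jacDefl_withKP_withKQ_add, droopQVL_jacDefl_eq, droopQVL_jacSlope_eq, droopQVL_jacSlopeKQ_eq, bxJ9,
    Matrix.submatrix_add, Matrix.submatrix_add, Matrix.submatrix_smul, Matrix.submatrix_smul]
  rfl

/-! ## §3 The multi-affine family over `ℝ` and the certificates on the whole box -/

/-- `S(s, t) = T₀₀ + s·T₁₀ + t·T₀₁ + st·T₁₁` over `ℝ` (flattened). [folklore] -/
def bxS9 (s t : ℝ) : Matrix (Fin 9) (Fin 9) ℝ :=
  bxT00Q.map ((↑) : ℚ → ℝ) + s • bxT10Q.map ((↑) : ℚ → ℝ) + t • bxT01Q.map ((↑) : ℚ → ℝ) + (s * t) • bxT11Q.map ((↑) : ℚ → ℝ)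

/-- `H(s, t) = S(−J′) + (S(−J′))ᵀ − 2·S` over `ℝ` (rate `r₀ = 1`). [folklore] -/
def bxH9 (s t : ℝ) : Matrix (Fin 9) (Fin 9) ℝ := bxS9 s t * (-bxJ9 s t) + (bxS9 s t * (-bxJ9 s t))ᵀ - (2 * (1 : ℝ)) • bxS9 s t

/-- The four structural zeros over `ℝ`. [folklore] -/
theorem bx_zero_products_real :
    bxT10Q.map ((↑) : ℚ → ℝ) * slope9Q.map ((↑) : ℚ → ℝ) = 0 ∧ bxT01Q.map ((↑) : ℚ → ℝ) * bxSlopeKQ9Q.map ((↑) : ℚ → ℝ) = 0 ∧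
    bxT11Q.map ((↑) : ℚ → ℝ) * slope9Q.map ((↑) : ℚ → ℝ) = 0 ∧ bxT11Q.map ((↑) : ℚ → ℝ) * bxSlopeKQ9Q.map ((↑) : ℚ → ℝ) = 0 := by
  obtain ⟨h1, h2, h3, h4⟩ := bx_zero_products
  refine ⟨?_, ?_, ?_, ?_⟩ <;> rw [← map_ratCast_mul] <;> simp [h1, h2, h3, h4]

/-- **`H(s, t)` is MULTI-AFFINE**: `H(s, t) = H₀₀ + s·H₁₀ + t·H₀₁ + st·H₁₁` with coefficients read off `lyapCert_biaffine`. [folklore] -/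
theorem bxH9_biaffine (s t : ℝ) : bxH9 s t
    = (bxT00Q.map ((↑) : ℚ → ℝ) * (-defl9Q.map ((↑) : ℚ → ℝ)) + (bxT00Q.map ((↑) : ℚ → ℝ) * (-defl9Q.map ((↑) : ℚ → ℝ)))ᵀ
          - (2 * (1 : ℝ)) • bxT00Q.map ((↑) : ℚ → ℝ))
      + s • (-(bxT00Q.map ((↑) : ℚ → ℝ) * slope9Q.map ((↑) : ℚ → ℝ) + bxT10Q.map ((↑) : ℚ → ℝ) * defl9Q.map ((↑) : ℚ → ℝ))
          - (bxT00Q.map ((↑) : ℚ → ℝ) * slope9Q.map ((↑) : ℚ → ℝ) + bxT10Q.map ((↑) : ℚ → ℝ) * defl9Q.map ((↑) : ℚ → ℝ))ᵀ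
          - (2 * (1 : ℝ)) • bxT10Q.map ((↑) : ℚ → ℝ))
      + t • (-(bxT00Q.map ((↑) : ℚ → ℝ) * bxSlopeKQ9Q.map ((↑) : ℚ → ℝ) + bxT01Q.map ((↑) : ℚ → ℝ) * defl9Q.map ((↑) : ℚ → ℝ))
          - (bxT00Q.map ((↑) : ℚ → ℝ) * bxSlopeKQ9Q.map ((↑) : ℚ → ℝ) + bxT01Q.map ((↑) : ℚ → ℝ) * defl9Q.map ((↑) : ℚ → ℝ))ᵀ
          - (2 * (1 : ℝ)) • bxT01Q.map ((↑) : ℚ → ℝ))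
      + (s * t) • (-(bxT10Q.map ((↑) : ℚ → ℝ) * bxSlopeKQ9Q.map ((↑) : ℚ → ℝ) + bxT01Q.map ((↑) : ℚ → ℝ) * slope9Q.map ((↑) : ℚ → ℝ)
            + bxT11Q.map ((↑) : ℚ → ℝ) * defl9Q.map ((↑) : ℚ → ℝ))
          - (bxT10Q.map ((↑) : ℚ → ℝ) * bxSlopeKQ9Q.map ((↑) : ℚ → ℝ) + bxT01Q.map ((↑) : ℚ → ℝ) * slope9Q.map ((↑) : ℚ → ℝ)
            + bxT11Q.map ((↑) : ℚ → ℝ) * defl9Q.map ((↑) : ℚ → ℝ))ᵀ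
          - (2 * (1 : ℝ)) • bxT11Q.map ((↑) : ℚ → ℝ)) := by
  obtain ⟨h1, h2, h3, h4⟩ := bx_zero_products_real
  rw [bxH9, bxS9, bxJ9]
  exact lyapCert_biaffine _ _ _ _ _ _ _ (2 * (1 : ℝ)) s t h1 h2 h3 h4

/-- `H` at a corner, read through the real pencil. [folklore] -/
theorem bxH9_ratCast (sq tq : ℚ) : bxH9 (sq : ℝ) (tq : ℝ)
    = ((bxT00Q + sq • bxT10Q + tq • bxT01Q + (sq * tq) • bxT11Q) * (-(defl9Q + sq • slope9Q + tq • bxSlopeKQ9Q))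
        + ((bxT00Q + sq • bxT10Q + tq • bxT01Q + (sq * tq) • bxT11Q) * (-(defl9Q + sq • slope9Q + tq • bxSlopeKQ9Q)))ᵀ
        - (2 * 1 : ℚ) • (bxT00Q + sq • bxT10Q + tq • bxT01Q + (sq * tq) • bxT11Q)).map ((↑) : ℚ → ℝ) := by
  rw [map_ratCast_lyapCert, map_ratCast_biaffine, bxH9, bxS9, bxJ9]
  have hJ : (defl9Q + sq • slope9Q + tq • bxSlopeKQ9Q).map ((↑) : ℚ → ℝ)
      = defl9Q.map ((↑) : ℚ → ℝ) + (sq : ℝ) • slope9Q.map ((↑) : ℚ → ℝ) + (tq : ℝ) • bxSlopeKQ9Q.map ((↑) : ℚ → ℝ) := by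
    rw [map_ratCast_add_smul, map_ratCast_add_smul]
  rw [hJ]
  push_cast
  rfl

/-- `S(s, t) ≻ 0` on the whole box (four corner certificates + `posDef_biaffine_of_corners`). CERTIFIED. [folklore] -/
theorem bxS9_posDef {s t : ℝ} (hs1 : -(143 : ℝ) / 100 ≤ s) (hs2 : s ≤ (757 : ℝ) / 100) (ht1 : -(1 : ℝ) / 10 ≤ t) (ht2 : t ≤ (1 : ℝ) / 5) :
    (bxS9 s t).PosDef := by
  have c11 := bxSAA_posDef; have c12 := bxSAB_posDef; have c21 := bxSBA_posDef; have c22 := bxSBB_posDef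
  rw [bxSAAQ, map_ratCast_biaffine] at c11; rw [bxSABQ, map_ratCast_biaffine] at c12
  rw [bxSBAQ, map_ratCast_biaffine] at c21; rw [bxSBBQ, map_ratCast_biaffine] at c22
  push_cast at c11 c12 c21 c22
  rw [bxS9]
  exact posDef_biaffine_of_corners c11 c12 c21 c22 (by linarith) (by linarith) (by linarith) (by linarith)

/-- `H(s, t) ≻ 0` on the whole box (four corner certificates + multi-affinity + `posDef_biaffine_of_corners`). CERTIFIED. [folklore] -/
theorem bxH9_posDef {s t : ℝ} (hs1 : -(143 : ℝ) / 100 ≤ s) (hs2 : s ≤ (757 : ℝ) / 100) (ht1 : -(1 : ℝ) / 10 ≤ t) (ht2 : t ≤ (1 : ℝ) / 5) :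
    (bxH9 s t).PosDef := by
  have c11 : (bxH9 ((((-143 : ℚ)/100 : ℚ)) : ℝ) ((((-1 : ℚ)/10 : ℚ)) : ℝ)).PosDef := by rw [bxH9_ratCast]; exact bxHAA_posDef
  have c12 : (bxH9 ((((-143 : ℚ)/100 : ℚ)) : ℝ) ((((1 : ℚ)/5 : ℚ)) : ℝ)).PosDef := by rw [bxH9_ratCast]; exact bxHAB_posDef
  have c21 : (bxH9 ((((757 : ℚ)/100 : ℚ)) : ℝ) ((((-1 : ℚ)/10 : ℚ)) : ℝ)).PosDef := by rw [bxH9_ratCast]; exact bxHBA_posDef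
  have c22 : (bxH9 ((((757 : ℚ)/100 : ℚ)) : ℝ) ((((1 : ℚ)/5 : ℚ)) : ℝ)).PosDef := by rw [bxH9_ratCast]; exact bxHBB_posDef
  rw [bxH9_biaffine] at c11 c12 c21 c22 ⊢
  push_cast at c11 c12 c21 c22
  exact posDef_biaffine_of_corners c11 c12 c21 c22 (by linarith) (by linarith) (by linarith) (by linarith)

/-! ## §4 The two-parameter statement -/

/-- **TWO-PARAMETER RATE STATEMENT for the lossy construction.** For ALL uniform droop gains `k_P ∈ [1, 10]` and `k_Q ∈ [1/10, 2/5]`, every complex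
eigenpair `(z, v)` of the `9 × 9` Jacobian `jacMatrix (θ*, V*)` of `droopQVLkq k_P k_Q` (= «DROOPQV-WSCC9-LOSSY» with P–f gains `k_P` and Q–V gains `k_Q`) is the
rotation mode (`z = 0`, `v ∈ ℂ·r`) or has `Re z < −1`. CERTIFIED (one multi-affine Lyapunov family, eight integer Gram certificates, deflation `γ = −3`);
MODELLED: MV-6N SYNTHETIC/CONSTRUCTION, lossy, both gains parameters; VALIDATED: float abscissa `∈ [-1.0926, -1.0215]` on the box. A statement about
the linearisation at ONE rest point over a BOX of gains — not a region of attraction; no stability sentence. [folklore] -/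
theorem droopQVL_gain2_eig_re_lt {k kq : ℝ} (hk1 : (1 : ℝ) ≤ k) (hk2 : k ≤ (10 : ℝ)) (hq1 : (1 : ℝ) / 10 ≤ kq) (hq2 : kq ≤ (2 : ℝ) / 5)
    {z : ℂ} {v : Fin 3 ⊕ (Fin 3 ⊕ Fin 3) → ℂ} (hv : v ≠ 0)
    (hJ : ((droopQVLkq k kq).jacMatrix droopQVL.angleOf droopQVL.Vstar).map ((↑) : ℝ → ℂ) *ᵥ v = z • v) :
    (z = 0 ∧ ∃ a : ℂ, v = fun i => a * (DroopMicrogrid.rot i : ℂ)) ∨ z.re < -1 := by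
  have h1 : -(143 : ℝ) / 100 ≤ k - 243 / 100 := by linarith
  have h2 : k - 243 / 100 ≤ (757 : ℝ) / 100 := by linarith
  have h3 : -(1 : ℝ) / 10 ≤ kq - 1 / 5 := by linarith
  have h4 : kq - 1 / 5 ≤ (1 : ℝ) / 5 := by linarith
  have hS : ((bxS9 (k - 243 / 100) (kq - 1 / 5)).submatrix e9 e9).PosDef := (bxS9_posDef h1 h2 h3 h4).submatrix e9.injective
  have hH : ((bxS9 (k - 243 / 100) (kq - 1 / 5)).submatrix e9 e9 * (-(droopQVLkq k kq).jacDefl droopQVL.angleOf droopQVL.Vstar zetaL)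
      + ((bxS9 (k - 243 / 100) (kq - 1 / 5)).submatrix e9 e9 * (-(droopQVLkq k kq).jacDefl droopQVL.angleOf droopQVL.Vstar zetaL))ᵀ
      - (2 * (1 : ℝ)) • (bxS9 (k - 243 / 100) (kq - 1 / 5)).submatrix e9 e9).PosDef := by
    rw [droopQVLkq_jacDefl_eq, lyapCert_submatrix]
    exact (bxH9_posDef h1 h2 h3 h4).submatrix e9.injective
  exact (droopQVLkq k kq).eig_re_lt_neg_of_deflate droopQVL.angleOf droopQVL.Vstar zetaL one_pos
    (by simpa using zetaL_gamma.trans (by norm_num : -((1041 : ℝ) / 1000) < -1)) hS hH hv hJ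

/-- **SIMPLE rotation zero on the whole box**: for all `(k_P, k_Q)` in the box no complex `w` solves `jacMatrix (θ*, V*) w = r` for `droopQVLkq k_P k_Q`.
CERTIFIED (same certificate family); MODELLED as above. No stability sentence. [folklore] -/
theorem droopQVL_gain2_no_jordan_chain_at_zero {k kq : ℝ} (hk1 : (1 : ℝ) ≤ k) (hk2 : k ≤ (10 : ℝ)) (hq1 : (1 : ℝ) / 10 ≤ kq) (hq2 : kq ≤ (2 : ℝ) / 5)
    {w : Fin 3 ⊕ (Fin 3 ⊕ Fin 3) → ℂ}
    (hw : ((droopQVLkq k kq).jacMatrix droopQVL.angleOf droopQVL.Vstar).map ((↑) : ℝ → ℂ) *ᵥ w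
      = fun i => ((DroopMicrogrid.rot i : ℝ) : ℂ)) : False := by
  have h1 : -(143 : ℝ) / 100 ≤ k - 243 / 100 := by linarith
  have h2 : k - 243 / 100 ≤ (757 : ℝ) / 100 := by linarith
  have h3 : -(1 : ℝ) / 10 ≤ kq - 1 / 5 := by linarith
  have h4 : kq - 1 / 5 ≤ (1 : ℝ) / 5 := by linarith
  have hS : ((bxS9 (k - 243 / 100) (kq - 1 / 5)).submatrix e9 e9).PosDef := (bxS9_posDef h1 h2 h3 h4).submatrix e9.injective
  have hH : ((bxS9 (k - 243 / 100) (kq - 1 / 5)).submatrix e9 e9 * (-(droopQVLkq k kq).jacDefl droopQVL.angleOf droopQVL.Vstar zetaL)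
      + ((bxS9 (k - 243 / 100) (kq - 1 / 5)).submatrix e9 e9 * (-(droopQVLkq k kq).jacDefl droopQVL.angleOf droopQVL.Vstar zetaL))ᵀ
      - (2 * (1 : ℝ)) • (bxS9 (k - 243 / 100) (kq - 1 / 5)).submatrix e9 e9).PosDef := by
    rw [droopQVLkq_jacDefl_eq, lyapCert_submatrix]
    exact (bxH9_posDef h1 h2 h3 h4).submatrix e9.injective
  exact (droopQVLkq k kq).no_jordan_chain_at_zero_of_deflate droopQVL.angleOf droopQVL.Vstar zetaL one_pos
    (by simpa using zetaL_gamma.trans (by norm_num : -((1041 : ℝ) / 1000) < -1)) hS hH hw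

end WSCC9

end Summit.Ventures.GridStability.Models

end
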